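import Literature.Analysis.FluidPDE.DirectionDissipation
import Literature.Analysis.FluidPDE.ConstantinDirectionDissipation
import Literature.Analysis.FluidPDE.SelfSimilar
import HarnessLib

/-!
# The scaled direction dissipation: untwisted fields, Constantin's budget, `nsRescale`

Companion lemmas for `scaledDirectionDissipation r z u = r⁻¹ ∫∫_{Q_r(z)} |ω| |∇ξ|²`
(`DirectionDissipation.lean`: `ω = curl u`, `ξ = ω/|ω|`, `Q_r(t, x) = (t − r², t) × B_r(x)`), the
quantity the routes `DirectionDissipationQuantum` and `DirectionEnergy` of
`Summits/NavierStokesRegularity` inline (the latter calls it Constantin's *scaled direction energy*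
`W(u; z, r)` and writes the density as `‖ω‖ₑ · ofReal |∇ξ|²`; the two renderings agree,
`scaledDirectionDissipation_eq_lintegral_enorm`). All statements are proved:

* `enormDirectionFunctional_eq_scaledDirectionDissipation` — the function-level form
  `(r ↦ r⁻¹ ∫∫_{Q_r(z)} ‖ω‖ₑ · ofReal |∇ξ|²) = (r ↦ scaledDirectionDissipation r z u)` of that
  bridge, for rewriting inside the `Tendsto (fun r => …)` hypotheses of route `DirectionEnergy`;
* `scaledDirectionDissipation_eq_zero_of_fderiv_eq_zero` — **untwisted fields** (`∇ξ = 0` at the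
  points of `Q_r(z)` where `ω ≠ 0`, the notion of route `DirectionEnergy`'s
  `UntwistedAncientLiouville`) have zero scaled direction dissipation (the collinear special case
  is `scaledDirectionDissipation_eq_zero_of_exists_smul`);
* `scaledDirectionDissipation_le_of_subset`, `scaledDirectionDissipation_le_slab` — comparison
  with the un-normalised integral over a larger set, in particular over the slab `(0, T) × ℝ³`
  when `r² ≤ t ≤ T`, whose integral is the left side of Constantin's a-priori bound;
* `constantin1990_direction_dissipation_bound.mul_scaledDirectionDissipation_le` — hence, under
  the named fact `constantin1990_direction_dissipation_bound` (Constantin 1990, (2.6)–(2.7),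
  (2.21)), for a classical Leray–Hopf solution on `[0, T)` from a rapidly decaying datum,
  `ν r W(u; (t, x), r) ≤ ‖ω₀‖_{L¹} + (2ν)⁻¹ ‖u₀‖²_{L²}` for every cylinder `Q_r(t, x)` in the slab:
  the **global budget** of the scaled direction dissipation (`W(r) = O(r⁻¹)`, uniformly in the
  centre);
* `scaledDirectionDissipation_nsRescale` — scale invariance in the `nsRescale` vocabulary of
  `SelfSimilar.lean`, `W(nsRescale c u; (t, x), r) = W(u; (c² t, c x), c r)` (from
  `scaledDirectionDissipation_nsZoom`).

Physical space is written `EuclideanSpace ℝ (Fin 3)` throughout (no local notation).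

## References

* P. Constantin, *Navier–Stokes equations and area of interfaces*, Comm. Math. Phys. 129 (1990),
  §2, (2.6)–(2.7), (2.21). [Constantin1990]
* P. Constantin, *Euler equations, Navier–Stokes equations and turbulence*, LNM 1871 (2006), §4,
  display after Thm. 4.1 (p. 47). [Constantin2006EulerNSTurbulence]
-/

noncomputable section

open MeasureTheory Set Function Filter Metric Topology
open scoped ENNReal

namespace Literature.Analysis.FluidPDE

/-! ### The `‖·‖ₑ` rendering, as functions of the radius -/

/-- Function-level bridge to the rendering inlined by route `DirectionEnergy`:
`(r ↦ r⁻¹ ∫∫_{Q_r(z)} ‖ω‖ₑ · ofReal |∇ξ|²) = (r ↦ scaledDirectionDissipation r z u)`, so that a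
hypothesis `Tendsto (fun r => r⁻¹ ∫∫_{Q_r(z)} ‖ω‖ₑ · ofReal |∇ξ|²) (𝓝[>] 0) (𝓝 0)` rewrites to
`Tendsto (fun r => scaledDirectionDissipation r z u) (𝓝[>] 0) (𝓝 0)`. [folklore] -/
theorem enormDirectionFunctional_eq_scaledDirectionDissipation
    (z : ℝ × EuclideanSpace ℝ (Fin 3))
    (u : ℝ → EuclideanSpace ℝ (Fin 3) → EuclideanSpace ℝ (Fin 3)) :
    (fun r : ℝ => (ENNReal.ofReal r)⁻¹ * ∫⁻ q in parabolicCylinder r z,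
        ‖curl (u q.1) q.2‖ₑ *
          ENNReal.ofReal (frobeniusNormSq (fderiv ℝ (vorticityDirection (curl (u q.1))) q.2))) =
      fun r => scaledDirectionDissipation r z u :=
  funext fun r => (scaledDirectionDissipation_eq_lintegral_enorm r z u).symm

/-! ### Untwisted fields -/

/-- **Untwisted fields have zero scaled direction dissipation**: if `∇ξ(t, ·)(x) = 0` at every
point `(t, x) ∈ Q_r(z)` with `ω(t, x) ≠ 0` (the points with `ω = 0` do not matter, the density
carrying the weight `|ω|`), then `r⁻¹ ∫∫_{Q_r(z)} |ω||∇ξ|² = 0`. This is the sense in which route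
`DirectionEnergy` calls a field *untwisted* (`UntwistedAncientLiouville`); collinear vorticity is
the special case `scaledDirectionDissipation_eq_zero_of_exists_smul`. [folklore] -/
theorem scaledDirectionDissipation_eq_zero_of_fderiv_eq_zero
    {u : ℝ → EuclideanSpace ℝ (Fin 3) → EuclideanSpace ℝ (Fin 3)} {r : ℝ}
    {z : ℝ × EuclideanSpace ℝ (Fin 3)}
    (h : ∀ q ∈ parabolicCylinder r z, curl (u q.1) q.2 ≠ 0 →
      fderiv ℝ (vorticityDirection (curl (u q.1))) q.2 = 0) :
    scaledDirectionDissipation r z u = 0 := by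
  have hcongr : ∫⁻ q in parabolicCylinder r z,
      ENNReal.ofReal (directionDissipationDensity u q.1 q.2) =
        ∫⁻ _ in parabolicCylinder r z, (0 : ℝ≥0∞) := by
    refine setLIntegral_congr_fun (isOpen_parabolicCylinder r z).measurableSet fun q hq => ?_
    by_cases h0 : curl (u q.1) q.2 = 0
    · rw [directionDissipationDensity_eq_zero_of_curl_eq_zero h0, ENNReal.ofReal_zero]
    · rw [directionDissipationDensity, h q hq h0, frobeniusNormSq_zero, mul_zero,
        ENNReal.ofReal_zero]
  rw [scaledDirectionDissipation, hcongr, lintegral_zero, mul_zero]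

/-! ### Comparison with the slab integral and Constantin's budget -/

/-- `r⁻¹ ∫∫_{Q_r(z)} |ω||∇ξ|² ≤ r⁻¹ ∫∫_S |ω||∇ξ|²` for every set `S ⊇ Q_r(z)`. [folklore] -/
theorem scaledDirectionDissipation_le_of_subset
    {u : ℝ → EuclideanSpace ℝ (Fin 3) → EuclideanSpace ℝ (Fin 3)} {r : ℝ}
    {z : ℝ × EuclideanSpace ℝ (Fin 3)} {S : Set (ℝ × EuclideanSpace ℝ (Fin 3))}
    (h : parabolicCylinder r z ⊆ S) :
    scaledDirectionDissipation r z u ≤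
      (ENNReal.ofReal r)⁻¹ * ∫⁻ q in S, ENNReal.ofReal (directionDissipationDensity u q.1 q.2) :=
  mul_le_mul_right (lintegral_mono_set h) _

/-- A backward cylinder `Q_r(t, x)` with `r² ≤ t ≤ T` lies in the slab `(0, T) × E`. [folklore] -/
theorem parabolicCylinder_subset_Ioo_prod_univ {E : Type*} [PseudoMetricSpace E] {r T : ℝ}
    {z : ℝ × E} (h0 : r ^ 2 ≤ z.1) (hT : z.1 ≤ T) :
    parabolicCylinder r z ⊆ Ioo 0 T ×ˢ (univ : Set E) :=
  prod_mono (Ioo_subset_Ioo (by linarith) hT) (subset_univ _)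

/-- For `r² ≤ t ≤ T`: `r⁻¹ ∫∫_{Q_r(t,x)} |ω||∇ξ|² ≤ r⁻¹ ∫∫_{(0,T) × ℝ³} |ω||∇ξ|²`, the right-hand
integral being the left side of Constantin's a-priori bound
`constantin1990_direction_dissipation_bound`. [folklore] -/
theorem scaledDirectionDissipation_le_slab
    {u : ℝ → EuclideanSpace ℝ (Fin 3) → EuclideanSpace ℝ (Fin 3)} {r T : ℝ}
    {z : ℝ × EuclideanSpace ℝ (Fin 3)} (h0 : r ^ 2 ≤ z.1) (hT : z.1 ≤ T) :
    scaledDirectionDissipation r z u ≤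
      (ENNReal.ofReal r)⁻¹ * ∫⁻ q in Ioo 0 T ×ˢ (univ : Set (EuclideanSpace ℝ (Fin 3))),
        ENNReal.ofReal (directionDissipationDensity u q.1 q.2) :=
  scaledDirectionDissipation_le_of_subset (parabolicCylinder_subset_Ioo_prod_univ h0 hT)

/-- **The global budget of the scaled direction dissipation.** Under Constantin's a-priori bound
(the named fact `constantin1990_direction_dissipation_bound`: Constantin 1990, (2.6)–(2.7) with the
energy inequality (2.21)), for `ν > 0`, a classical solution of the unforced Navier–Stokes
equations on `ℝ³ × [0, T)` which is Leray–Hopf from its rapidly decaying datum, and any backward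
cylinder `Q_r(t, x)` inside the slab (`0 < r`, `r² ≤ t ≤ T`):
`ν · r · (r⁻¹ ∫∫_{Q_r(t,x)} |ω||∇ξ|²) ≤ ‖ω(·,0)‖_{L¹} + (2ν)⁻¹ ‖u(·,0)‖²_{L²}`,
i.e. `W(u; (t, x), r) ≤ (ν r)⁻¹ (‖ω₀‖₁ + (2ν)⁻¹‖u₀‖₂²)` uniformly in the centre.
[cite: Constantin1990, §2 eqs. (2.6)–(2.7) and (2.21)] -/
theorem constantin1990_direction_dissipation_bound.mul_scaledDirectionDissipation_le
    (h : constantin1990_direction_dissipation_bound) {ν T : ℝ} (hν : 0 < ν) (hT : 0 < T)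
    {u : ℝ → EuclideanSpace ℝ (Fin 3) → EuclideanSpace ℝ (Fin 3)}
    {p : ℝ → EuclideanSpace ℝ (Fin 3) → ℝ} (hns : IsClassicalNSSolutionOn (Set.Ico 0 T) ν 0 u p)
    (hlh : IsLerayHopfOn T ν 0 (u 0) u) (hdec : HasRapidSpatialDecay (u 0)) {r t : ℝ}
    (hr : 0 < r) (hrt : r ^ 2 ≤ t) (htT : t ≤ T) (x : EuclideanSpace ℝ (Fin 3)) :
    ENNReal.ofReal ν * (ENNReal.ofReal r * scaledDirectionDissipation r (t, x) u) ≤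
      (∫⁻ y, ‖curl (u 0) y‖ₑ) + (ENNReal.ofReal (2 * ν))⁻¹ * ∫⁻ y, ‖u 0 y‖ₑ ^ 2 := by
  have hsub : parabolicCylinder r ((t, x) : ℝ × EuclideanSpace ℝ (Fin 3)) ⊆
      Ioo 0 T ×ˢ (univ : Set (EuclideanSpace ℝ (Fin 3))) :=
    parabolicCylinder_subset_Ioo_prod_univ hrt htT
  have h1 : ENNReal.ofReal r * scaledDirectionDissipation r (t, x) u ≤
      ∫⁻ q in Ioo 0 T ×ˢ (univ : Set (EuclideanSpace ℝ (Fin 3))),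
        ENNReal.ofReal (directionDissipationDensity u q.1 q.2) := by
    rw [ofReal_mul_scaledDirectionDissipation hr]
    exact lintegral_mono_set hsub
  exact (mul_le_mul_right h1 _).trans (h ν T hν hT u p hns hlh hdec)

/-! ### Scale invariance in the `nsRescale` vocabulary -/

/-- **Scale invariance under `nsRescale`** (`nsRescale c u (s, y) = c u(c² s, c y)`,
`SelfSimilar.lean`), `c > 0`:
`r⁻¹∫∫_{Q_r(t,x)} (|ω||∇ξ|²)[nsRescale c u] = (c r)⁻¹ ∫∫_{Q_{cr}(c²t, cx)} (|ω||∇ξ|²)[u]`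
(`scaledDirectionDissipation_nsZoom` with `t₀ = 0`, `x₀ = 0`). [folklore] -/
theorem scaledDirectionDissipation_nsRescale {c : ℝ} (hc : 0 < c) (r : ℝ)
    (z : ℝ × EuclideanSpace ℝ (Fin 3))
    (u : ℝ → EuclideanSpace ℝ (Fin 3) → EuclideanSpace ℝ (Fin 3)) :
    scaledDirectionDissipation r z (nsRescale c u) =
      scaledDirectionDissipation (c * r) (c ^ 2 * z.1, c • z.2) u := by
  have h1 : nsRescale c u = c • stPull (c ^ 2) c 0 (0 : EuclideanSpace ℝ (Fin 3)) u := by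
    funext s y
    rw [nsRescale_apply, smul_stPull_apply, zero_add, zero_add]
  have h2 : stAffine (c ^ 2) c 0 (0 : EuclideanSpace ℝ (Fin 3)) z = (c ^ 2 * z.1, c • z.2) := by
    rw [stAffine, zero_add, zero_add]
  rw [h1, scaledDirectionDissipation_nsZoom hc, h2]

/-- In particular, about the space–time origin: `W(nsRescale c u; 0, r) = W(u; 0, c r)` for
`c > 0` (the normalisation used for blow-up sequences `u^{(k)} = nsRescale R_k u` after translating
the singular point to the origin). [folklore] -/
theorem scaledDirectionDissipation_nsRescale_zero {c : ℝ} (hc : 0 < c) (r : ℝ)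
    (u : ℝ → EuclideanSpace ℝ (Fin 3) → EuclideanSpace ℝ (Fin 3)) :
    scaledDirectionDissipation r ((0 : ℝ), (0 : EuclideanSpace ℝ (Fin 3))) (nsRescale c u) =
      scaledDirectionDissipation (c * r) ((0 : ℝ), (0 : EuclideanSpace ℝ (Fin 3))) u := by
  rw [scaledDirectionDissipation_nsRescale hc, mul_zero, smul_zero]

end Literature.Analysis.FluidPDE
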